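import Literature.AlgebraicGeometry.HodgeTheory.FermatHodgeCharacterCriterion
import Literature.AlgebraicGeometry.HodgeTheory.FermatHodgeCharacterLocal
import Literature.AlgebraicGeometry.HodgeTheory.FermatShiodaCondition
import HarnessLib

/-!
# Aoki's criterion at the conductor `q` for Hodge multisets of level `p·q`

Line `cancel-by-any-claim-lattice` (crux `HodgeFermatVarieties`, stmt-HodgeConjecture-1334),
level-`5q` programme, stub `stub_twoPrime_level_right`.

Let `p ≠ q` be primes and `s` a Hodge multiset of residues mod `p·q`
(`FermatCharacter.IsHodgeMultiset`). A non-zero `x ∈ ℤ/pq` is a unit (exact level `pq`), or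
`x = p·w` with `w` a unit mod `q` (level `q`), or `x = q·w'` (level `p`, `x ≡ 0 mod q`). Aoki's
criterion (`FermatCharacter.IsHodge.aoki_criterion`, [Aoki1983, Prop. 2.2]) at the conductor `f = q`
with an odd non-trivial (= odd primitive, `q` prime) character `χ` mod `q` reads
`Σ_{units x ∈ s} (1 − χ(p))·χ(x mod q)⁻¹ + Σ_{level-q x = p·w ∈ s} (p − 1)·χ(w)⁻¹ = 0`
(`χ(q) = 0`, `φ(pq)/φ(q) = p − 1`), and `χ(w)⁻¹ = χ(p)·χ(x mod q)⁻¹`; the level-`p` entries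
contribute `0` on both sides (`q ∤ p`, resp. `χ(0)⁻¹ = 0`). This is `stub_twoPrime_level_right`:
the sum over `s` of `(1 − χ p)·χ(x mod q)⁻¹` (units) resp. `(p − 1)·χ(p)·χ(x mod q)⁻¹` (non-units)
vanishes.

## References

* [Aoki1983] N. Aoki, On some arithmetic problems related to the Hodge cycles on the Fermat
  varieties, Math. Ann. 266 (1983) 23–54, Prop. 2.1, Prop. 2.2, Lemma 2.3 (through
  `FermatHodgeCharacterCriterion`).
-/

set_option linter.dupNamespace false

noncomputable section

open Finset
open Literature.AlgebraicGeometry.HodgeTheory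
open Literature.AlgebraicGeometry.HodgeTheory.FermatCharacter

namespace Summit.HodgeConjecture.HodgeConjecture.Theorems.CancelByAnyClaimLattice.FiveQ

/-- The divisors of a product of two primes `p·q` are `1`, `p`, `q`, `p·q`. [folklore] -/
private theorem eq_of_dvd_prime_mul {p q M : ℕ} (hp : p.Prime) (hq : q.Prime) (hM : M ∣ p * q) :
    M = 1 ∨ M = p ∨ M = q ∨ M = p * q := by
  obtain ⟨a, b, ha, hb, rfl⟩ := Nat.dvd_mul.mp hM
  rcases (Nat.dvd_prime hp).mp ha with rfl | rfl <;>
    rcases (Nat.dvd_prime hq).mp hb with rfl | rfl <;> simp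

/-- **Termwise identification.** For a level `M ∣ p·q`, a unit `v` mod `M` and
`x = (pq/M)·v ∈ ℤ/pq`, the `M`-term of Aoki's criterion at the conductor `q`,
`[q ∣ M] · (φ(pq)/φ(M)) · ∏_{r ∣ M} (1 − χ r) · χ(v mod q)⁻¹`, equals `(1 − χ p)·χ(x mod q)⁻¹` if
`x` is a unit (`M = pq`), `(p − 1)·χ(p)·χ(x mod q)⁻¹` otherwise (`M = q`: `x mod q = p·v`; `M = p`
or `M = 1`: both sides vanish, `q ∤ M` and `x mod q = 0`). [folklore] -/
private theorem term_eq {p q : ℕ} [hp : Fact p.Prime] [hq : Fact q.Prime] (hpq : p ≠ q)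
    (χ : DirichletCharacter ℂ q) {M : ℕ} (hM : M ∣ p * q) (v : ℕ) (hv : v.Coprime M)
    (x : ZMod (p * q)) [Decidable (IsUnit x)]
    (hx : x = ((p * q / M : ℕ) : ZMod (p * q)) * (v : ZMod (p * q))) :
    (if q ∣ M then (((p * q).totient : ℂ) / (M.totient : ℂ)) *
        (∏ r ∈ M.primeFactors, (1 - χ r)) * (χ (v : ZMod q))⁻¹ else 0) =
      (if IsUnit x then (1 - χ (p : ZMod q)) else ((p - 1 : ℕ) : ℂ) * χ (p : ZMod q)) *
        (χ (ZMod.castHom (dvd_mul_left q p) (ZMod q) x))⁻¹ := by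
  have hp' := hp.out
  have hq' := hq.out
  have hq0 : χ (0 : ZMod q) = 0 := MulChar.map_zero χ
  have hqq : χ (q : ZMod q) = 0 := by rw [ZMod.natCast_self]; exact hq0
  have hpu : IsUnit (p : ZMod q) := (ZMod.isUnit_prime_iff_not_dvd hp').mpr
    (fun h ↦ hpq ((Nat.prime_dvd_prime_iff_eq hp' hq').mp h))
  have hχp : χ (p : ZMod q) ≠ 0 := (hpu.map χ).ne_zero
  rcases eq_of_dvd_prime_mul hp' hq' hM with hM1 | hM1 | hM1 | hM1 <;> rw [hM1] at hv hx ⊢ <;>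
    clear hM hM1
  · -- `M = 1`: `x = 0`
    have hx0 : ZMod.castHom (dvd_mul_left q p) (ZMod q) x = 0 := by
      rw [hx, Nat.div_one, ZMod.natCast_self, zero_mul, map_zero]
    have h1 : ¬ q ∣ 1 := fun h ↦ hq'.one_lt.ne' (Nat.dvd_one.mp h)
    rw [if_neg h1, hx0, hq0, inv_zero, mul_zero]
  · -- `M = p`: level `p`, `x ≡ 0 mod q`
    have h1 : ¬ q ∣ p := fun h ↦ hpq ((Nat.prime_dvd_prime_iff_eq hq' hp').mp h).symm
    have hx0 : ZMod.castHom (dvd_mul_left q p) (ZMod q) x = 0 := by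
      rw [hx, Nat.mul_div_cancel_left q hp'.pos, ← Nat.cast_mul, map_natCast, Nat.cast_mul,
        ZMod.natCast_self, zero_mul]
    rw [if_neg h1, hx0, hq0, inv_zero, mul_zero]
  · -- `M = q`: level `q`, `x = p·v`
    have hpv : x = ((p * v : ℕ) : ZMod (p * q)) := by
      rw [hx, Nat.mul_div_cancel p hq'.pos, Nat.cast_mul]
    have hnu : ¬ IsUnit x := by
      rw [hpv, ZMod.isUnit_iff_coprime]
      exact Nat.not_coprime_of_dvd_of_dvd hp'.one_lt (dvd_mul_right p v) (dvd_mul_right p q)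
    have hcast : ZMod.castHom (dvd_mul_left q p) (ZMod q) x = (p : ZMod q) * (v : ZMod q) := by
      rw [hpv, map_natCast, Nat.cast_mul]
    have htot : (((p * q).totient : ℂ) / (q.totient : ℂ)) = ((p - 1 : ℕ) : ℂ) := by
      rw [Nat.totient_mul ((Nat.coprime_primes hp' hq').mpr hpq), Nat.cast_mul,
        mul_div_cancel_right₀ _ (by exact_mod_cast (Nat.totient_pos.mpr hq'.pos).ne'),
        Nat.totient_prime hp']
    rw [if_pos dvd_rfl, if_neg hnu, htot, hq'.primeFactors, prod_singleton, hqq, sub_zero, mul_one,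
      hcast, map_mul, mul_inv, ← mul_assoc, mul_inv_cancel_right₀ hχp]
  · -- `M = p·q`: `x = v` is a unit
    have hxv : x = (v : ZMod (p * q)) := by
      rw [hx, Nat.div_self (Nat.mul_pos hp'.pos hq'.pos), Nat.cast_one, one_mul]
    have hu : IsUnit x := by rw [hxv, ZMod.isUnit_iff_coprime]; exact hv
    have hcast : ZMod.castHom (dvd_mul_left q p) (ZMod q) x = (v : ZMod q) := by
      rw [hxv, map_natCast]
    have htot : (((p * q).totient : ℂ) / ((p * q).totient : ℂ)) = 1 :=
      div_self (by exact_mod_cast (Nat.totient_pos.mpr (Nat.mul_pos hp'.pos hq'.pos)).ne')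
    rw [if_pos (dvd_mul_left q p), if_pos hu, htot, one_mul,
      Nat.primeFactors_mul hp'.ne_zero hq'.ne_zero, hp'.primeFactors, hq'.primeFactors, ← insert_eq,
      prod_pair hpq, hqq, sub_zero, mul_one, hcast]

/-- **Aoki's criterion at the conductor `q` for a Hodge multiset of level `p·q`** (`p ≠ q` primes,
`χ` an odd non-trivial character mod `q`): writing `x mod q` for the reduction of `x ∈ ℤ/pq`,
`Σ_{x ∈ s} c(x)·χ(x mod q)⁻¹ = 0` with `c(x) = 1 − χ(p)` for units `x` and `c(x) = (p − 1)·χ(p)`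
otherwise. This is [Aoki1983, Prop. 2.2] (`FermatCharacter.IsHodge.aoki_criterion`) at `f = q`,
`m = pq`: a unit has level `pq` (term `(1 − χ p)(1 − χ q)χ(x)⁻¹`, `χ(q) = 0`), a non-unit with
`x mod q ≠ 0` is `p·w` of level `q` (term `φ(p)·χ(w)⁻¹ = (p − 1)χ(p)χ(x mod q)⁻¹`), and the entries
with `x mod q = 0` contribute `0` on both sides. [cite: Aoki1983, Prop. 2.2] -/
theorem stub_twoPrime_level_right :
    ∀ (p q : ℕ) [Fact p.Prime] [Fact q.Prime], p ≠ q → ∀ s : Multiset (ZMod (p * q)),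
      IsHodgeMultiset s → ∀ χ : DirichletCharacter ℂ q, χ.Odd → χ ≠ 1 →
        (s.map fun x ↦
          (if IsUnit x then (1 - χ (p : ZMod q)) else ((p - 1 : ℕ) : ℂ) * χ (p : ZMod q)) *
            (χ (ZMod.castHom (dvd_mul_left q p) (ZMod q) x))⁻¹).sum = 0 := by
  intro p q hp hq hpq s hs χ hχ hχ1
  haveI : NeZero q := ⟨hq.out.ne_zero⟩
  haveI : NeZero (p * q) := ⟨mul_ne_zero hp.out.ne_zero hq.out.ne_zero⟩
  have hprim : χ.IsPrimitive := by
    rw [DirichletCharacter.isPrimitive_def]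
    rcases (Nat.dvd_prime hq.out).mp (DirichletCharacter.conductor_dvd_level χ) with h | h
    · exact absurd (DirichletCharacter.eq_one_iff_conductor_eq_one.mpr h) hχ1
    · exact h
  obtain ⟨r, α, hα, rfl⟩ := hs.exists_isHodge
  have hM : ∀ i, (p * q / (p * q).gcd (α i).val) ∣ p * q := fun i ↦ (exists_unit_lift_eq (α i)).1
  choose w hw hwα using fun i ↦ (exists_unit_lift_eq (m := p * q) (α i)).2
  haveI : ∀ i, NeZero (p * q / (p * q).gcd (α i).val) := fun i ↦
    ⟨ne_zero_of_dvd_ne_zero (NeZero.ne (p * q)) (hM i)⟩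
  have key := hα.aoki_criterion (dvd_mul_left q p) hχ hprim
    (fun i ↦ p * q / (p * q).gcd (α i).val) hM w hw (fun i ↦ (hwα i).symm)
  rw [Multiset.map_map, ← Finset.sum_eq_multiset_sum]
  refine (Finset.sum_congr rfl fun i _ ↦ ?_).trans key
  have hv : (w i).val.Coprime (p * q / (p * q).gcd (α i).val) :=
    (ZMod.isUnit_iff_coprime _ _).mp (by rw [ZMod.natCast_zmod_val]; exact hw i)
  rw [Function.comp_apply, ZMod.cast_eq_val]
  exact (term_eq hpq χ (hM i) (w i).val hv (α i) (hwα i).symm).symm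

end Summit.HodgeConjecture.HodgeConjecture.Theorems.CancelByAnyClaimLattice.FiveQ
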